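import Summits.CriticalPhenomena.CardyFormulaZ2.Theorems.CardyAnchoredRigidityStretchedPullbackNotTargetBlindCharts
import Summits.CriticalPhenomena.CardyFormulaZ2.Theorems.CardyAnchoredRigidityStretchedPullbackNotTargetBlindStretch
import Summits.CriticalPhenomena.CardyFormulaZ2.Theorems.CardyAnchoredRigidityStretchedPullbackNotTargetBlindCrossingIdentity
import Summits.CriticalPhenomena.CardyFormulaZ2.Theorems.CardyAnchoredRigidityStretchedPullbackNotTargetBlindRealLemma

/-!
# The radial-stretch pullback of the SLE₆ family is not target independent

Helper file for route CardyAnchoredRigidity, item stmt-CriticalPhenomena-14488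
(`StretchedPullbackNotTargetBlind`): the core theorem `not_isTargetIndependent_of_isStretch`.

Let `S` be a chordal family of SLE₆ laws with the splitting form of locality (target independence)
and `P D := (Ψ_{D.pt 1})⁻¹_* S(Ψ_{D.pt 1} D)` its pullback along a target-anchored field `b ↦ Ψ b` of
plane homeomorphisms such that `Ψ 0` and `Ψ 1` are the radial stretches `z ↦ b + (z - b)|z - b|^α`
about `b = 0` and `b = 1` (`0 < α ≤ 1`). Then `P` is NOT target independent.

Proof (files `…HitsBefore`, `…Rectangles`, `…CrossingIdentity`, `…HalfDiscChart`,
`…SymmetricChart`, `…Charts`, `…Stretch`, `…RealLemma`): if it were, the stretched test rectangles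
`Ψ₀ R`, `Ψ₁ R`, `R = (bigRect; -1/2, 0, 1, y)`, would have equal conformal moduli for every `y > 1`
(`crossRatio_eq_of_targetIndependent`: Cardy's formula for SLE₆ on both sides). Computing both moduli
with the symmetric charts of `Ψ₀ bigRect`, `Ψ₁ bigRect` based at `1` (whose boundary correspondences
along the real axis are explicit) turns this into an identity of cross-ratios of the real four-tuples
`(k₁(-1/2), k₁ 0, 0, k₁ y)` and `(k₀(-1/2), k₀ 0, 0, k₀ y)`, `kᵢ = diamParam ∘ Re Gᵢ ∘ Ψᵢ`. But `Ψ₁` is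
flat at its centre `1` (`Ψ₁ y - 1 = (y-1)^{1+α}`) while `Ψ₀ y - 1 ∼ (1+α)(y-1)`, and the charts are
conformal (bi-Lipschitz) at `1`: `k₁ y = O((y-1)^{1+α})`, `k₀ y ≥ c (y-1)`, which the identity forbids
(`false_of_cr4_eq_of_flat_of_linear`). Inputs from the tree: Cardy's formula for SLE₆
(`sle_six_measureReal_hitsBefore_holds`), monotonicity of Cardy's function, existence of uniformizing
data and intrinsicness of the cross-ratio, the symmetric Riemann map, the Joukowski half-disc map;
no named (unproved) facts.
-/

noncomputable section

open Set Filter Metric Topology Complex Function MeasureTheory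
open UpperHalfPlane (upperHalfPlaneSet isOpen_upperHalfPlaneSet)

namespace Summit.CriticalPhenomena.CardyFormulaZ2.Theorems.StretchedPullback

open Literature.Probability.RandomPlanarGeometry

/-- `diamParam p ≤ 1/2` (AM–GM). -/
theorem diamParam_le_half (p : ℝ) : diamParam p ≤ 1 / 2 := by
  rw [diamParam, div_le_iff₀ (by positivity)]
  nlinarith [sq_nonneg (p - 1)]

/-- The marked points of the test rectangle as real numbers: `(a, 0, 1, y)`. -/
theorem rect4_pt_eq {a y : ℝ} (ha : a ∈ Ioo (-10 : ℝ) 0) (hy : y ∈ Ioo (1 : ℝ) 10) (i : Fin 4) :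
    (rect4 a y ha hy).pt i = ((![a, 0, 1, y] i : ℝ) : ℂ) := by
  fin_cases i
  · exact rect4_pt_zero ha hy
  · simpa using rect4_pt_one ha hy
  · simpa using rect4_pt_two ha hy
  · exact rect4_pt_three ha hy

/-- The cross-ratio of a four-tuple read through a function. -/
theorem crossRatio_comp_vec (k : ℝ → ℝ) (a b c d : ℝ) :
    crossRatio (fun i => k (![a, b, c, d] i)) = cr4 (k a) (k b) (k c) (k d) := by
  simp [crossRatio, cr4]

/-! ### The boundary coordinate of a stretched rectangle through its symmetric chart -/

section Coordinate

variable {Φ : ℂ ≃ₜ ℂ} {b α : ℝ} (h : ∀ z : ℂ, Φ z = stretchFn b α z) (hα : 0 ≤ α) (hα1 : α ≤ 1)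
  (hb : b ∈ Icc (0 : ℝ) 1) (Γ : SymChart (Φ '' bigRect.carrier))

/-- **The boundary coordinate** `k m = diamParam (Re G (Φ m))` of the real point `m`, read through the
stretch `Φ` and the symmetric chart `G` of `Φ bigRect`. -/
def kfun (Φ : ℂ ≃ₜ ℂ) (Γ : SymChart (Φ '' bigRect.carrier)) (m : ℝ) : ℝ :=
  diamParam (Γ.G (Φ m)).re

include h hα hα1 hb in
/-- For `m ∈ (-1, 2)` the stretched point `Φ m` is a real number in the free segment `(-7, 9)`. -/
theorem re_stretch_mem {m : ℝ} (hm : m ∈ Ioo (-1 : ℝ) 2) : (Φ (m : ℂ)).re ∈ Ioo (-7 : ℝ) 9 := by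
  have h1 : |m - b| < 2 := by
    rw [abs_lt]; constructor <;> linarith [hm.1, hm.2, hb.1, hb.2]
  have h2 := abs_lt.1 (Stretch.abs_re_sub_lt h hα hα1 h1)
  constructor <;> linarith [h2.1, h2.2, hb.1, hb.2]

include h in
/-- On the real axis the stretch takes real values. -/
theorem stretch_ofReal_eq (m : ℝ) : Φ (m : ℂ) = (((Φ (m : ℂ)).re : ℝ) : ℂ) := by
  rw [Stretch.apply_ofReal h, ofReal_re]

include h hα hα1 hb in
/-- **Boundary values of the chart uniformizer at the stretched marks**: for `m ∈ (-1, 2)`,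
`Γ.unif` has boundary value `Φ m` at `k m`. -/
theorem unif_hasBoundaryValue {m : ℝ} (hm : m ∈ Ioo (-1 : ℝ) 2) :
    Γ.unif.HasBoundaryValue (kfun Φ Γ m : ℝ) (Φ (m : ℂ)) := by
  have ht := re_stretch_mem h hα hα1 hb hm
  have := Γ.hasBoundaryValue ht
  rw [← stretch_ofReal_eq h m] at this
  exact this

include h hα hα1 hb in
/-- The boundary coordinate is strictly increasing on `(-1, 2)`. -/
theorem strictMonoOn_kfun : StrictMonoOn (kfun Φ Γ) (Ioo (-1 : ℝ) 2) := by
  intro m hm m' hm' hmm'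
  have ht := re_stretch_mem h hα hα1 hb hm
  have ht' := re_stretch_mem h hα hα1 hb hm'
  simp only [kfun]
  rw [stretch_ofReal_eq h m, stretch_ofReal_eq h m']
  have h1 : (Φ (m : ℂ)).re < (Φ (m' : ℂ)).re := Stretch.strictMono_re h hα hmm'
  have h2 := Γ.strictMonoOn_re ht ht' h1
  simp only at h2
  have h3 := Γ.re_mem_Ioo ht
  have h4 := Γ.re_mem_Ioo ht'
  exact strictMonoOn_diamParam (Ioo_subset_Icc_self h3) (Ioo_subset_Icc_self h4) h2

include h hα hb in
/-- The stretch about `b ∈ {0, 1}` fixes the point `1` (`Φ 1 = b + (1 - b)^{1+α}`). -/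
theorem stretch_one (hb' : b = 0 ∨ b = 1) : Φ ((1 : ℝ) : ℂ) = ((1 : ℝ) : ℂ) := by
  rw [Stretch.apply_ofReal_of_le h hα hb.2]
  rcases hb' with rfl | rfl <;> simp [Real.zero_rpow (by linarith : (1 : ℝ) + α ≠ 0)]

include h hα hb in
/-- `k 1 = 0`. -/
theorem kfun_one (hb' : b = 0 ∨ b = 1) : kfun Φ Γ 1 = 0 := by
  simp only [kfun]
  rw [stretch_one h hα hb hb', Γ.hG1, zero_re, diamParam_zero]

/-- `k m ≤ 1`. -/
theorem kfun_le_one (m : ℝ) : kfun Φ Γ m ≤ 1 :=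
  (diamParam_le_half _).trans (by norm_num)

include h hα in
/-- **Flatness at the centre.** For the stretch centred at `b = 1`:
`k y ≤ 2 c (y - 1)^{1+α}` for `y ↓ 1`. -/
theorem kfun_le_of_center_one (hb1 : b = 1) :
    ∃ ρ > 0, ∀ y : ℝ, 1 < y → y < 1 + ρ → kfun Φ Γ y ≤ 2 * Γ.c * (y - 1) ^ (1 + α) := by
  subst hb1
  obtain ⟨ρ, hρ, hG⟩ := Γ.re_le_two_mul
  refine ⟨min 1 ρ, lt_min one_pos hρ, fun y hy1 hyρ => ?_⟩
  have ht0 : 0 < y - 1 := by linarith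
  have ht1 : y - 1 < 1 := by linarith [min_le_left (1 : ℝ) ρ]
  have htρ : y - 1 < ρ := by linarith [min_le_right (1 : ℝ) ρ]
  set d : ℝ := (y - 1) ^ (1 + α) with hd
  have hd0 : 0 < d := Real.rpow_pos_of_pos ht0 _
  have hdle : d ≤ y - 1 := by
    have := Real.rpow_le_rpow_of_exponent_ge ht0 ht1.le (by linarith : (1 : ℝ) ≤ 1 + α)
    rwa [Real.rpow_one] at this
  have hΦ : Φ (y : ℂ) = ((1 + d : ℝ) : ℂ) := Stretch.apply_ofReal_of_le h hα hy1.le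
  have h1 := hG d hd0 (by linarith)
  simp only [kfun]
  rw [hΦ]
  set p : ℝ := (Γ.G ((1 + d : ℝ) : ℂ)).re with hp
  have h2 : 0 ≤ 2 * Γ.c * d := by have := Γ.hc; positivity
  rcases le_or_gt 0 p with hp0 | hp0
  · exact (diamParam_le_self hp0).trans h1
  · exact (diamParam_neg hp0).le.trans h2

include h hα hα1 in
/-- **Linear growth away from the centre.** For the stretch centred at `b = 0`:
`k y ≥ (c/4)(y - 1)` for `y ↓ 1`. -/
theorem le_kfun_of_center_zero (hb0 : b = 0) :
    ∃ ρ > 0, ∀ y : ℝ, 1 < y → y < 1 + ρ → Γ.c / 4 * (y - 1) ≤ kfun Φ Γ y := by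
  subst hb0
  obtain ⟨ρ, hρ, hG⟩ := Γ.half_mul_le_re
  refine ⟨min 1 (ρ / 3), lt_min one_pos (by positivity), fun y hy1 hyρ => ?_⟩
  have ht0 : 0 < y - 1 := by linarith
  have ht1 : y - 1 < 1 := by linarith [min_le_left (1 : ℝ) (ρ / 3)]
  have htρ : y - 1 < ρ / 3 := by linarith [min_le_right (1 : ℝ) (ρ / 3)]
  set d : ℝ := y ^ (1 + α) - 1 with hd
  have hy0 : (1 : ℝ) ≤ y := hy1.le
  have hlow : y - 1 ≤ d := by
    have := Real.rpow_le_rpow_of_exponent_le hy0 (by linarith : (1 : ℝ) ≤ 1 + α)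
    rw [Real.rpow_one] at this
    linarith
  have hup : d ≤ 3 * (y - 1) := by
    have h1 := Real.rpow_le_rpow_of_exponent_le hy0 (by linarith : 1 + α ≤ (2 : ℝ))
    rw [Real.rpow_two] at h1
    nlinarith
  have hd0 : 0 < d := by linarith
  have hΦ : Φ (y : ℂ) = ((1 + d : ℝ) : ℂ) := by
    rw [Stretch.apply_ofReal_of_le h hα (by linarith : (0 : ℝ) ≤ y)]
    congr 1
    rw [hd]
    simp
  have h1 := hG d hd0 (by linarith)
  simp only [kfun]
  rw [hΦ]
  set p : ℝ := (Γ.G ((1 + d : ℝ) : ℂ)).re with hp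
  have hp0 : 0 ≤ p := by have := Γ.hc; nlinarith
  have hp1 : p ≤ 1 := by
    have : (1 + d) ∈ Ioo (-7 : ℝ) 9 := ⟨by linarith, by linarith⟩
    exact (Γ.re_mem_Ioo this).2.le
  have h2 := half_le_diamParam hp0 hp1
  have := Γ.hc
  nlinarith

end Coordinate

/-! ### The theorem -/

/-- **The radial-stretch pullback of the SLE₆ family is not target independent.** Let `S` be a
chordal family of SLE₆ laws which is target independent, `Ψ` a target-anchored field of plane
homeomorphisms with `Ψ 0`, `Ψ 1` the radial stretches of exponent `α ∈ (0, 1]` about `0` and `1`,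
and `P D = (Ψ_{D.pt 1})⁻¹_* S(Ψ_{D.pt 1} D)`. Then `P` is not target independent. -/
theorem not_isTargetIndependent_of_isStretch {α : ℝ} (hα : 0 < α) (hα1 : α ≤ 1)
    {Ψ : ℂ → ℂ ≃ₜ ℂ} (h0 : ∀ z : ℂ, Ψ 0 z = stretchFn 0 α z) (h1 : ∀ z : ℂ, Ψ 1 z = stretchFn 1 α z)
    {S P : ChordalFamily} (hS : ∀ D : DobrushinDomain, IsSLELaw 6 D (S D))
    (hTI : S.IsTargetIndependent)
    (hP : ∀ D : DobrushinDomain,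
      P D = (S (D.map (Ψ (D.pt 1)))).map (CurveClass.map ((Ψ (D.pt 1)).symm : C(ℂ, ℂ)))) :
    ¬ P.IsTargetIndependent := by
  intro hPTI
  have hb0 : (0 : ℝ) ∈ Icc (0 : ℝ) 1 := ⟨le_rfl, zero_le_one⟩
  have hb1 : (1 : ℝ) ∈ Icc (0 : ℝ) 1 := ⟨zero_le_one, le_rfl⟩
  -- symmetric charts of the two stretched rectangles
  obtain ⟨Γ₀⟩ := exists_symChart (U := Ψ 0 '' bigRect.carrier) isOpen_image_bigRect
    isPreconnected_image_bigRect hasSqrt_image_bigRect (image_bigRect_subset_upperHalfPlaneSet h0)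
    (by rw [ofReal_one]; exact ball_inter_subset_image_bigRect h0 hα.le hb0)
  obtain ⟨Γ₁⟩ := exists_symChart (U := Ψ 1 '' bigRect.carrier) isOpen_image_bigRect
    isPreconnected_image_bigRect hasSqrt_image_bigRect (image_bigRect_subset_upperHalfPlaneSet h1)
    (by rw [ofReal_one]; exact ball_inter_subset_image_bigRect h1 hα.le hb1)
  have ha : (-1 / 2 : ℝ) ∈ Ioo (-10 : ℝ) 0 := ⟨by norm_num, by norm_num⟩
  have haI : (-1 / 2 : ℝ) ∈ Ioo (-1 : ℝ) 2 := ⟨by norm_num, by norm_num⟩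
  have h0I : (0 : ℝ) ∈ Ioo (-1 : ℝ) 2 := ⟨by norm_num, by norm_num⟩
  have h1I : (1 : ℝ) ∈ Ioo (-1 : ℝ) 2 := ⟨by norm_num, by norm_num⟩
  have hk₀1 : kfun (Ψ 0) Γ₀ 1 = 0 := kfun_one h0 hα.le hb0 Γ₀ (Or.inl rfl)
  have hk₁1 : kfun (Ψ 1) Γ₁ 1 = 0 := kfun_one h1 hα.le hb1 Γ₁ (Or.inr rfl)
  have hmono₀ := strictMonoOn_kfun h0 hα.le hα1 hb0 Γ₀
  have hmono₁ := strictMonoOn_kfun h1 hα.le hα1 hb1 Γ₁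
  -- (1) the cross-ratio identity for every test parameter `y ∈ (1, 2)`
  have hid : ∀ y ∈ Ioo (1 : ℝ) 2,
      cr4 (kfun (Ψ 1) Γ₁ (-1 / 2)) (kfun (Ψ 1) Γ₁ 0) 0 (kfun (Ψ 1) Γ₁ y) = cr4 (kfun (Ψ 0) Γ₀ (-1 / 2)) (kfun (Ψ 0) Γ₀ 0) 0 (kfun (Ψ 0) Γ₀ y) := by
    intro y hy
    have hy' : y ∈ Ioo (1 : ℝ) 10 := ⟨hy.1, by linarith [hy.2]⟩
    have hyI : y ∈ Ioo (-1 : ℝ) 2 := ⟨by linarith [hy.1], hy.2⟩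
    set R := rect4 (-1 / 2) y ha hy' with hR
    obtain ⟨ψ₀, x₀, hψ₀⟩ := MarkedDomain.exists_isUniformizing_holds (R.map (Ψ 0))
    obtain ⟨ψ₁, x₁, hψ₁⟩ := MarkedDomain.exists_isUniformizing_holds (R.map (Ψ 1))
    have e := crossRatio_eq_of_targetIndependent hS hTI hP hPTI ha hy' hψ₀ hψ₁
    -- the marks of `R`, as reals, all lie in `(-1, 2)`
    have hpts : ∀ i : Fin 4, (![-1 / 2, 0, 1, y] i : ℝ) ∈ Ioo (-1 : ℝ) 2 := by
      intro i; fin_cases i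
      · exact haI
      · exact h0I
      · exact h1I
      · exact hyI
    -- transfer both cross-ratios to the chart data
    have e₀ : crossRatio x₀ = crossRatio (fun i => kfun (Ψ 0) Γ₀ (![-1 / 2, 0, 1, y] i)) := by
      refine crossRatio_eq_of_hasBoundaryValue (R := R.map (Ψ 0)) (φ' := Γ₀.unif)
        hψ₀.hasBoundaryValue fun i => ?_
      rw [MarkedDomain.pt_map, rect4_pt_eq ha hy']
      exact unif_hasBoundaryValue h0 hα.le hα1 hb0 Γ₀ (hpts i)
    have e₁ : crossRatio x₁ = crossRatio (fun i => kfun (Ψ 1) Γ₁ (![-1 / 2, 0, 1, y] i)) := by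
      refine crossRatio_eq_of_hasBoundaryValue (R := R.map (Ψ 1)) (φ' := Γ₁.unif)
        hψ₁.hasBoundaryValue fun i => ?_
      rw [MarkedDomain.pt_map, rect4_pt_eq ha hy']
      exact unif_hasBoundaryValue h1 hα.le hα1 hb1 Γ₁ (hpts i)
    rw [e₀, e₁, crossRatio_comp_vec, crossRatio_comp_vec, hk₀1, hk₁1] at e
    exact e.symm
  -- (2) flatness of `kfun (Ψ 1) Γ₁`, linear growth of `kfun (Ψ 0) Γ₀` at `y = 1`
  obtain ⟨ρ₁, hρ₁, hflat⟩ := kfun_le_of_center_one h1 hα.le Γ₁ rfl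
  obtain ⟨ρ₀, hρ₀, hlin⟩ := le_kfun_of_center_zero h0 hα.le hα1 Γ₀ rfl
  -- (3) the real-variable contradiction on `(1, 1 + δ)`, `δ = min 1 (min ρ₀ ρ₁)`
  set δ : ℝ := min 1 (min ρ₀ ρ₁) with hδ
  have hδpos : 0 < δ := lt_min one_pos (lt_min hρ₀ hρ₁)
  have hδ1 : δ ≤ 1 := min_le_left _ _
  have hδρ₀ : δ ≤ ρ₀ := (min_le_right _ _).trans (min_le_left _ _)
  have hδρ₁ : δ ≤ ρ₁ := (min_le_right _ _).trans (min_le_right _ _)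
  have hsub : ∀ y ∈ Ioo 1 (1 + δ), y ∈ Ioo (1 : ℝ) 2 := fun y hy =>
    ⟨hy.1, by linarith [hy.2]⟩
  refine false_of_cr4_eq_of_flat_of_linear hα (A₀ := kfun (Ψ 0) Γ₀ (-1 / 2)) (B₀ := kfun (Ψ 0) Γ₀ 0)
    (A₁ := kfun (Ψ 1) Γ₁ (-1 / 2)) (B₁ := kfun (Ψ 1) Γ₁ 0) (Y₀ := kfun (Ψ 0) Γ₀) (Y₁ := kfun (Ψ 1) Γ₁) (C := 2 * Γ₁.c) (c := Γ₀.c / 4)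
    (hmono₀ haI h0I (by norm_num)) (by simpa only [hk₀1] using hmono₀ h0I h1I zero_lt_one)
    (hmono₁ haI h0I (by norm_num)) (by simpa only [hk₁1] using hmono₁ h0I h1I zero_lt_one)
    hδpos (by have := Γ₀.hc; positivity) ?_ ?_ ?_ ?_ ?_ ?_
  · intro y hy
    simpa only [hk₀1] using hmono₀ h1I ⟨by linarith [hy.1], by linarith [hy.2]⟩ hy.1
  · intro y _
    exact kfun_le_one Γ₀ y
  · intro y hy
    simpa only [hk₁1] using hmono₁ h1I ⟨by linarith [hy.1], by linarith [hy.2]⟩ hy.1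
  · intro y hy
    exact hid y (hsub y hy)
  · intro y hy
    exact hflat y hy.1 (by linarith [hy.2])
  · intro y hy
    exact hlin y hy.1 (by linarith [hy.2])

end Summit.CriticalPhenomena.CardyFormulaZ2.Theorems.StretchedPullback
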